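import Literature.MathematicalPhysics.QuantumFieldTheory.Balaban1983to89.B8Prop7AdmittedFamily
import Literature.MathematicalPhysics.QuantumFieldTheory.Balaban1983to89.B7TranslationCovariance
import HarnessLib

/-!
# T⁴ programme, node NE3 — census R50 (M4): the TOP DATA of the zeroth-order frame gauge are UNITARY and PERIODIC — translation covariance of the `k`-fold double-bar average and
# of the accumulated frame, and the `U(n)`-valuedness of `v_k` from [Balaban1985RegularSpaces] Prop. 7's tower (`FrameNormalisationAdmissibleTop`)

Cell `pub-balaban-gaps` (track G2, seat ne3, generation 11), row NE3; census `HOME/ne/NE3.md` §4 R50, §17.  `FrameNormalisationAdmissible` propagates subgroup membership and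
periodicity of a hierarchically block-covariantly-constant gauge from its top corner data `c(z) = u₀(L^kz)⁻¹·v_k(U₀′)(z)`; this module supplies the two top-data facts.

* §1 `dbavgCovIter_vcov_shiftCfg` — joint translation covariance of the `j`-fold double-bar average (91) and of the accumulated frame (97): translating `(U₀, U₁)` by `L^j a` translates
  `U̿₁ʲ` and `v_j` by `a` (induction over `B7TranslationCovariance.dbavgCov_shiftCfg`, `wframe_shiftCfg`, `shiftCfg_avgIter`); hence **`vcov_add_period`**: for `(N·L^k)`-periodic
  `U₀, U₁` the accumulated frame `v_k` is `N`-periodic on `Ω^{(k)}`.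
* §2 **`vcov_mem_unitaryUnits`** — under the tower hypotheses of [Balaban1985RegularSpaces] Prop. 7 (`B8Prop7AdmittedFamily.dbavgCovIter_vcov_mem_unitaryUnits`: unitary `W`, `U₀′ = e^{B}`
  unitary, the [B7]-Prop-4 windows of `W` and of `U₀′W`) `v_k(U₀′)` is unitary — restated for `M_n(ℂ)`; and **`topData_mem_unitaryUnits`**: so is `u₀(L^kz)⁻¹·v_k(U₀′)(z)` for unitary `u₀`.

HONEST FRAMING (page 1).  Bookkeeping over landed theorems BY NAME (0 def, 0 sorry); nothing of Bałaban's asserted; the smooth∕joint realisation of (1.37) with (1.38) is NOT touched;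
**NE3 NOT proved**; spine PROVED 0∕9; finite T⁴ rung (B)+1 — NOT continuum YM on ℝ⁴, NOT infinite volume, NOT mass gap, NOT `BetaPertH`, NOT Clay.  HONEST DEPENDENCY: continuum YM on T⁴ ⇐
BetaPertH ∧ nine spine estimates (0/9 proved); BetaPertH ⇐ (D1) ∧ (D4) ∧ CAP+tail; G-an2-4 gates asym, D1 and NE2/3/4.  PLACEMENT: `Summits/QuantumFields/BalabanUV/T4Continuum/Spine/NE3/`; imports the Literature modules
`B8Prop7AdmittedFamily` and `B7TranslationCovariance` only (its consumers are `FrameNormalisationAdmissible.mem_of_hier` ∕ `periodic_of_hier`).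
-/

set_option autoImplicit false

open scoped BigOperators Matrix Matrix.Norms.L2Operator
open NormedSpace

namespace Summit.QuantumFields.BalabanUV.T4Continuum.NE3.FrameNormalisationAdmissibleTop

open Literature.MathematicalPhysics.QuantumFieldTheory.Balaban1983to89
open B7Prop1Explicit B7Prop2Explicit B7Prop3Flat MatrixLog
open B7Eq92Concrete (vcov vcov_zero vcov_succ dbavgCovIter dbavgCovIter_zero dbavgCovIter_succ wframe)
open B12Ineq417Flat (shiftCfg shiftCfg_apply)
open B7TranslationCovariance (dbavgCov_shiftCfg wframe_shiftCfg shiftCfg_avgIter)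

noncomputable section

variable {d : ℕ} {n : Type*} [Fintype n] [DecidableEq n]

/-! ## §1 Translation covariance of the `j`-fold double-bar average and of the accumulated frame; periodicity of `v_k` -/

/-- **JOINT TRANSLATION COVARIANCE OF `U̿₁ʲ` (91) AND `v_j` (97)**: `U̿₁ʲ(z + a) = U̿₁ʲ[t_{L^ja}U₀, t_{L^ja}U₁](z)` and `v_j(z + a) = v_j[t_{L^ja}U₀, t_{L^ja}U₁](z)`. [folklore] -/
theorem dbavgCovIter_vcov_shiftCfg (L : ℕ) (U₀ U₁ : Site d → Fin d → (Matrix n n ℂ)ˣ) :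
    ∀ (j : ℕ) (a : Site d),
      (∀ (z : Site d) (κ : Fin d), dbavgCovIter L U₀ U₁ j (z + a) κ
          = dbavgCovIter L (shiftCfg (((L : ℤ) ^ j) • a) U₀) (shiftCfg (((L : ℤ) ^ j) • a) U₁) j z κ) ∧
      (∀ z : Site d, vcov L U₀ U₁ j (z + a) = vcov L (shiftCfg (((L : ℤ) ^ j) • a) U₀) (shiftCfg (((L : ℤ) ^ j) • a) U₁) j z)
  | 0, a => ⟨fun z κ => by simp [shiftCfg], fun z => by rw [vcov_zero, vcov_zero]⟩
  | j + 1, a => by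
    -- level-`j` objects translated by `L • a`
    have ih := dbavgCovIter_vcov_shiftCfg L U₀ U₁ j ((L : ℤ) • a)
    have hpow : ((L : ℤ) ^ j) • ((L : ℤ) • a) = ((L : ℤ) ^ (j + 1)) • a := by rw [smul_smul, ← pow_succ]
    have hD : shiftCfg ((L : ℤ) • a) (dbavgCovIter L U₀ U₁ j)
        = dbavgCovIter L (shiftCfg (((L : ℤ) ^ (j + 1)) • a) U₀) (shiftCfg (((L : ℤ) ^ (j + 1)) • a) U₁) j := by
      funext x μ; rw [shiftCfg_apply, ih.1 x μ, hpow]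
    have hW : shiftCfg ((L : ℤ) • a) (avgIter L U₀ j) = avgIter L (shiftCfg (((L : ℤ) ^ (j + 1)) • a) U₀) j := by
      rw [shiftCfg_avgIter, hpow]
    refine ⟨fun z κ => ?_, fun z => ?_⟩
    · rw [dbavgCovIter_succ, dbavgCovIter_succ, smul_add, ← dbavgCov_shiftCfg L ((L : ℤ) • a), hW, hD]
    · rw [vcov_succ, vcov_succ, smul_add, ih.2 ((L : ℤ) • z), hpow, ← wframe_shiftCfg L ((L : ℤ) • a), hW, hD]

/-- **THE ACCUMULATED FRAME OF PERIODIC DATA IS PERIODIC**: if `U₀`, `U₁` are `(N·L^k)`-periodic then `v_k(z + N e_j) = v_k(z)`. [folklore] -/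
theorem vcov_add_period (L N k : ℕ) {U₀ U₁ : Site d → Fin d → (Matrix n n ℂ)ˣ}
    (hU₀ : ∀ (x : Site d) (κ : Fin d) (j : Fin d), U₀ (x + ((N * L ^ k : ℕ) : ℤ) • e j) κ = U₀ x κ)
    (hU₁ : ∀ (x : Site d) (κ : Fin d) (j : Fin d), U₁ (x + ((N * L ^ k : ℕ) : ℤ) • e j) κ = U₁ x κ) (z : Site d) (j : Fin d) :
    vcov L U₀ U₁ k (z + (N : ℤ) • e j) = vcov L U₀ U₁ k z := by
  have h := (dbavgCovIter_vcov_shiftCfg L U₀ U₁ k ((N : ℤ) • e j)).2 z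
  have hs : ((L : ℤ) ^ k) • ((N : ℤ) • e j) = ((N * L ^ k : ℕ) : ℤ) • e j := by
    rw [smul_smul]; push_cast; ring_nf
  have h0 : shiftCfg (((L : ℤ) ^ k) • ((N : ℤ) • e j)) U₀ = U₀ := by
    funext x κ; rw [shiftCfg_apply, hs, hU₀]
  have h1 : shiftCfg (((L : ℤ) ^ k) • ((N : ℤ) • e j)) U₁ = U₁ := by
    funext x κ; rw [shiftCfg_apply, hs, hU₁]
  rw [h, h0, h1]

/-! ## §2 The accumulated frame is unitary ([Balaban1985RegularSpaces] Prop. 7's tower), hence so are the top data -/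

/-- **`v_k(e^{B})` IS UNITARY** under the tower hypotheses of `B8Prop7AdmittedFamily.dbavgCovIter_vcov_mem_unitaryUnits` (unitary `W`, `e^{B}` unitary, the [B7]-Prop-4 windows of `W`
and of `e^{B}·W`), restated for `M_n(ℂ)`. [folklore] -/
theorem vcov_mem_unitaryUnits [Nonempty n] (hd : 1 ≤ d) {L k : ℕ} (hL : 2 ≤ L) {W : Site d → Fin d → (Matrix n n ℂ)ˣ} {B : Site d → Fin d → Matrix n n ℂ}
    {α₀ αP b : ℝ} (hWu : ∀ (x : Site d) (κ : Fin d), W x κ ∈ unitaryUnits (Matrix n n ℂ))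
    (hBu : ∀ (x : Site d) (κ : Fin d), expCfg B x κ ∈ unitaryUnits (Matrix n n ℂ))
    (hα : 0 < α₀) (hα3 : C0 d * α₀ ≤ 1 / 3) (hα4 : 4 * α₀ ≤ c2' d L) (h52 : pdev W < α₀ * (((L : ℝ) ^ k)⁻¹) ^ 2)
    (hb : 0 ≤ b) (hB : ∀ (x : Site d) (κ : Fin d), ‖B x κ‖ ≤ b)
    (hsmall : Real.exp (4 * (800 * ((d : ℝ) + 1) ^ 2 * ((d : ℝ) + 4)) * α₀) * (1 + 8 * (131072 * ((d : ℝ) + 1) ^ 2) * ((L : ℝ) ^ k * b)) ≤ 2)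
    (hc₃ : 2 * ((L : ℝ) ^ k * b) ≤ c3 d L) (hsm : 2048 * (d : ℝ) * ((L : ℝ) ^ k * b) ≤ 1)
    (hαP : 0 < αP) (hαP3 : C0 d * αP ≤ 1 / 3) (hαP2 : 2 * αP ≤ c2' d L) (hP : pdev (expCfg B * W) < αP * (((L : ℝ) ^ k)⁻¹) ^ 2)
    (z : Site d) : vcov L W (expCfg B) k z ∈ unitaryUnits (Matrix n n ℂ) := by
  letI : CStarAlgebra (Matrix n n ℂ) := {}
  exact ((B8Prop7AdmittedFamily.dbavgCovIter_vcov_mem_unitaryUnits hd hL hWu hBu hα hα3 hα4 h52 hb hB hsmall hc₃ hsm hαP hαP3 hαP2 hP) k le_rfl).2 z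

/-- **THE TOP DATA `u₀(L^kz)⁻¹·v_k(U₀′)(z)` ARE UNITARY** for a unitary pre-gauge `u₀` and unitary `v_k(U₀′)`. [folklore] -/
theorem topData_mem_unitaryUnits {L k : ℕ} {u₀ : Site d → (Matrix n n ℂ)ˣ} {W U₀' : Site d → Fin d → (Matrix n n ℂ)ˣ}
    (hu₀ : ∀ x : Site d, u₀ x ∈ unitaryUnits (Matrix n n ℂ)) (hv : ∀ z : Site d, vcov L W U₀' k z ∈ unitaryUnits (Matrix n n ℂ)) (z : Site d) :
    (u₀ (((L : ℤ) ^ k) • z))⁻¹ * vcov L W U₀' k z ∈ unitaryUnits (Matrix n n ℂ) :=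
  (unitaryUnits (Matrix n n ℂ)).mul_mem ((unitaryUnits (Matrix n n ℂ)).inv_mem (hu₀ _)) (hv z)

end

end Summit.QuantumFields.BalabanUV.T4Continuum.NE3.FrameNormalisationAdmissibleTop
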